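/-
Copyright (c) 2026 the pub-hodgecm-mathlib formalisation cell (harness21).  Prover seat hodgecm-mathlib-K2Liu-p11 (g0), Track B «K2-LIT»,
#184♮ = hLiu418 = `stmt-HodgeConjecture-24832`; LEAD F0P6-plan (g13) 09:26:41Z «= TYPE `archNormalisedScalarCont : ℤ → ℂ → ℂ` (S) with
the three letters» (one total name for the CONTINUED normalised archimedean scalar; removes the «plug `s = ½` into the raw integral» trap).
DEFINITIONS `oddNormalisedForm`, `archNormalisedScalarCont` + letters.
-/
import Summits.HodgeConjecture.HodgeConjecture.Theorems.K2LiuArchIntertwiningScalarKernel   -- ★ (this seat): `normalisedScalar_*`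
import HarnessLib

/-!
# Crux `HLiu418`, A∞ organ: the CONTINUED normalised archimedean scalar `n_k(s)` as one total function (letter file)

Cell `hodgecm-mathlib`, crux item hLiu418 = `stmt-HodgeConjecture-24832` (helper lane `--supports`, count-neutral; definition lane).

`archNormalisedScalarCont k s` is THE name consumers cite for the scalar by which the normalised intertwining operator `M*_w(s)` acts on the
scalar `K_w`-type `k` of `I_w(s)` — CONTINUED in `s`:
* `k = ±1` (the pinned Gaussian line): the constant `1`;
* odd `|k| = 2m+3`: the explicit holomorphic form `oddNormalisedForm m` of ★ `normalisedScalar_odd_eq`;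
* even `k` (the other parity class, a pole at `½`): the raw `2Q(s)⁻¹c_k(s)` (no continuation claimed).
LETTERS: (L1) `archNormalisedScalarCont_eq (hs : ½ < re s) : archNormalisedScalarCont k s = 2·Q(s)⁻¹·c_k(s)` (every `k`) and
`archIntertwiningNormalized_archScalarSection_eq_cont : M*_w(s) f⁰_{s,k} = archNormalisedScalarCont k s · f⁰_{−s,k}` on `U(2,2)`, `re s > ½`;
(L2) `differentiableOn_archNormalisedScalarCont (hk : Odd k)` on `{0 < re s}`; (L3) `archNormalisedScalarCont_half_of_natAbs_eq_one = 1`,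
`archNormalisedScalarCont_half_eq_zero (hk : Odd k) (h : k.natAbs ≠ 1) = 0` — the (A∞-½) value∕kernel on scalar types BY NAME.
References: [Shimura1982, (1.31)], [KudlaRallis1994 (citation only)] — derived.
HONEST LABEL: HC_CM is proved only modulo the 7 printed citations (2 remaining named inputs: hLiu418 = stmt-HodgeConjecture-24832,
h413 = stmt-HodgeConjecture-24833) until rung 0 closes; count-neutral helper, closes no socket.
-/

set_option autoImplicit false
set_option linter.dupNamespace false

noncomputable section

open Complex Matrix
open scoped ComplexOrder

namespace Summit.HodgeConjecture.HodgeConjecture.Cruxes.HLiu418.K2LiuArchNormalisedScalarCont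

open Summit.HodgeConjecture.HodgeConjecture.Cruxes.HLiu418.K2LiuArchInducedTubeDefs
open Summit.HodgeConjecture.HodgeConjecture.Cruxes.HLiu418.K2LiuArchNormalisingScalar
open Summit.HodgeConjecture.HodgeConjecture.Cruxes.HLiu418.K2LiuArchIntertwiningScalarKernel

/-! ## §1  Definitions -/

/-- The explicit holomorphic form of the normalised scalar on the odd type `|k| = 2m+3` (★ `normalisedScalar_odd_eq`):
`(s+k/2)(s−k/2)(s+½)⁻¹(s−½)·Γ(s+3/2)²·Γ(s+1+k/2)⁻²·(∏_{i<m}(s−½−m+i))²`. -/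
def oddNormalisedForm (m : ℕ) (s : ℂ) : ℂ :=
  (s + ((2 * (m : ℤ) + 3 : ℤ) : ℂ) / 2) * (s - ((2 * (m : ℤ) + 3 : ℤ) : ℂ) / 2) * (s + 1 / 2)⁻¹ * (s - 1 / 2) *
    Complex.Gamma (s + 3 / 2) ^ 2 * ((Complex.Gamma (s + 1 + ((2 * (m : ℤ) + 3 : ℤ) : ℂ) / 2))⁻¹) ^ 2 *
      (∏ i ∈ Finset.range m, (s - 1 / 2 - m + i)) ^ 2

/-- **THE CONTINUED NORMALISED ARCHIMEDEAN SCALAR `n_k(s)`** on the scalar `K_w`-type `k` (Kudla–Rallis normalisation pinned to `1` on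
`k = ±1`): `1` on `k = ±1`; the explicit holomorphic form on odd `|k| = 2m+3`; the raw `2Q(s)⁻¹c_k(s)` on even `k`. -/
def archNormalisedScalarCont (k : ℤ) (s : ℂ) : ℂ :=
  if k.natAbs = 1 then 1
  else if Odd k then oddNormalisedForm ((k.natAbs - 3) / 2) s
  else 2 * (archNormalisingScalar s)⁻¹ * archScalarCoeff k s

/-- Unfolding of `oddNormalisedForm`. -/
theorem oddNormalisedForm_def (m : ℕ) (s : ℂ) :
    oddNormalisedForm m s = (s + ((2 * (m : ℤ) + 3 : ℤ) : ℂ) / 2) * (s - ((2 * (m : ℤ) + 3 : ℤ) : ℂ) / 2) * (s + 1 / 2)⁻¹ * (s - 1 / 2) *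
      Complex.Gamma (s + 3 / 2) ^ 2 * ((Complex.Gamma (s + 1 + ((2 * (m : ℤ) + 3 : ℤ) : ℂ) / 2))⁻¹) ^ 2 *
        (∏ i ∈ Finset.range m, (s - 1 / 2 - m + i)) ^ 2 := rfl

/-! ## §2  Integer bookkeeping -/

/-- An odd integer with `|k| ≠ 1` is `±(2m+3)` with `m = (|k| − 3)/2`. [folklore] -/
theorem eq_or_eq_neg_of_odd {k : ℤ} (hk : Odd k) (h1 : k.natAbs ≠ 1) :
    k = ((2 * (((k.natAbs - 3) / 2 : ℕ) : ℤ) + 3 : ℤ)) ∨ k = -((2 * (((k.natAbs - 3) / 2 : ℕ) : ℤ) + 3 : ℤ)) := by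
  obtain ⟨j, rfl⟩ := hk
  rcases Int.natAbs_eq (2 * j + 1) with h | h <;> omega

/-! ## §3  The letters -/

/-- On the pinned types the continued scalar is `1`. -/
theorem archNormalisedScalarCont_of_natAbs_eq_one {k : ℤ} (h : k.natAbs = 1) (s : ℂ) : archNormalisedScalarCont k s = 1 := by
  simp [archNormalisedScalarCont, h]

/-- On an odd type `|k| ≠ 1` the continued scalar is the explicit odd form. -/
theorem archNormalisedScalarCont_of_odd {k : ℤ} (hk : Odd k) (h1 : k.natAbs ≠ 1) (s : ℂ) :
    archNormalisedScalarCont k s = oddNormalisedForm ((k.natAbs - 3) / 2) s := by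
  simp [archNormalisedScalarCont, h1, hk]

/-- On an even type the continued scalar is the raw ratio (no continuation claimed). -/
theorem archNormalisedScalarCont_of_even {k : ℤ} (hk : Even k) (s : ℂ) :
    archNormalisedScalarCont k s = 2 * (archNormalisingScalar s)⁻¹ * archScalarCoeff k s := by
  have h1 : k.natAbs ≠ 1 := by
    intro h
    obtain ⟨j, hj⟩ := hk
    rcases Int.natAbs_eq k with h' | h' <;> omega
  have hodd : ¬ Odd k := Int.not_odd_iff_even.mpr hk
  simp [archNormalisedScalarCont, h1, hodd]

/-- **(L1) AGREEMENT WITH THE RAW NORMALISED SCALAR on `re s > ½`**: `archNormalisedScalarCont k s = 2·Q(s)⁻¹·c_k(s)` for every `k : ℤ`. -/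
theorem archNormalisedScalarCont_eq (k : ℤ) {s : ℂ} (hs : 1 / 2 < s.re) :
    archNormalisedScalarCont k s = 2 * (archNormalisingScalar s)⁻¹ * archScalarCoeff k s := by
  by_cases h1 : k.natAbs = 1
  · rw [archNormalisedScalarCont_of_natAbs_eq_one h1]
    rcases Int.natAbs_eq k with h | h <;> rw [h1] at h <;> simp only [Nat.cast_one] at h <;> rw [h]
    · exact (normalisedScalar_one hs).symm
    · exact (normalisedScalar_neg_one hs).symm
  · by_cases hk : Odd k
    · rw [archNormalisedScalarCont_of_odd hk h1, oddNormalisedForm_def]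
      rcases eq_or_eq_neg_of_odd hk h1 with h | h
      · conv_rhs => rw [h]
        exact (normalisedScalar_odd_eq _ hs).symm
      · conv_rhs => rw [h, normalisedScalar_neg_odd_eq]
        exact (normalisedScalar_odd_eq _ hs).symm
    · exact archNormalisedScalarCont_of_even (Int.not_odd_iff_even.mp hk) s

/-- **(L1′) THE NORMALISED OPERATOR ON SCALAR TYPES, BY THE CONTINUED NAME**: on `U(2,2)`, `re s > ½`,
`M*_w(s) f⁰_{s,k} = archNormalisedScalarCont k s · f⁰_{−s,k}`. -/
theorem archIntertwiningNormalized_archScalarSection_eq_cont (k : ℤ) {s : ℂ} (hs : 1 / 2 < s.re)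
    {h : Matrix (Fin 2 ⊕ Fin 2) (Fin 2 ⊕ Fin 2) ℂ} (hh : hᴴ * Matrix.J (Fin 2) ℂ * h = Matrix.J (Fin 2) ℂ) :
    archIntertwiningNormalized s (archScalarSection k s) h = archNormalisedScalarCont k s * archScalarSection k (-s) h := by
  rw [archNormalisedScalarCont_eq k hs, archIntertwiningNormalized_archScalarSection k hs hh]

/-- **(L2) HOLOMORPHY ON `{0 < re s}`** for every odd `k` (the parity class of the pinned line). -/
theorem differentiableOn_archNormalisedScalarCont {k : ℤ} (hk : Odd k) :
    DifferentiableOn ℂ (archNormalisedScalarCont k) {s : ℂ | 0 < s.re} := by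
  by_cases h1 : k.natAbs = 1
  · have h : archNormalisedScalarCont k = fun _ => (1 : ℂ) := funext fun s => archNormalisedScalarCont_of_natAbs_eq_one h1 s
    rw [h]
    exact differentiableOn_const 1
  · have h : archNormalisedScalarCont k = fun s => oddNormalisedForm ((k.natAbs - 3) / 2) s :=
      funext fun s => archNormalisedScalarCont_of_odd hk h1 s
    rw [h]
    exact differentiableOn_normalisedScalarOdd _

/-- **(L3a) VALUE AT `½` ON THE PINNED TYPES**: `n_{±1}(½) = 1`. -/
theorem archNormalisedScalarCont_half_of_natAbs_eq_one {k : ℤ} (h : k.natAbs = 1) : archNormalisedScalarCont k (1 / 2) = 1 :=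
  archNormalisedScalarCont_of_natAbs_eq_one h _

/-- **(L3b) THE KERNEL AT `½`**: `n_k(½) = 0` for every odd `k` with `|k| ≠ 1`. -/
theorem archNormalisedScalarCont_half_eq_zero {k : ℤ} (hk : Odd k) (h1 : k.natAbs ≠ 1) : archNormalisedScalarCont k (1 / 2) = 0 := by
  rw [archNormalisedScalarCont_of_odd hk h1, oddNormalisedForm_def]
  exact normalisedScalarOdd_half _

/-- `n_{−k} = n_k`. -/
theorem archNormalisedScalarCont_neg (k : ℤ) (s : ℂ) : archNormalisedScalarCont (-k) s = archNormalisedScalarCont k s := by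
  by_cases h1 : k.natAbs = 1
  · rw [archNormalisedScalarCont_of_natAbs_eq_one h1, archNormalisedScalarCont_of_natAbs_eq_one (by rwa [Int.natAbs_neg])]
  · by_cases hk : Odd k
    · rw [archNormalisedScalarCont_of_odd hk h1, archNormalisedScalarCont_of_odd (Odd.neg hk) (by rwa [Int.natAbs_neg]), Int.natAbs_neg]
    · have he : Even k := Int.not_odd_iff_even.mp hk
      rw [archNormalisedScalarCont_of_even he, archNormalisedScalarCont_of_even (Even.neg he), archScalarCoeff_neg]

end Summit.HodgeConjecture.HodgeConjecture.Cruxes.HLiu418.K2LiuArchNormalisedScalarCont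

end
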